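import Summits.Ventures.PercRepro.RankLevelSetTelForm

/-!
# PercRepro — S2: THE COLOOP TELESCOPING, PART 1 — the level step and the non-coloop count of the level-`7` core
(p8, gen 20; a feeder for S4 — the top of the `q = 7` window, the rows `64` and below)

A level-`m` rank-`q` set `B` (`|B| = m = q + ν`) has `m − |K|` NON-COLOOPS (`y ∈ B` with `r(B ∖ y) = q`), `K` its
coloops; each non-coloop `y` gives the level-`(m − 1)` set `B ∖ y` WITH THE SAME CLOSURE (`y ∈ cl(B ∖ y)`), and a
level-`(m − 1)` set `S` extends to at most `|cl S| − |S|` level-`m` sets `S ∪ {y}`, `y ∈ cl S ∖ S`. So, with `ρ ≤ m − |K|`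
on every level-`m` set and `|cl S| ≤ cap` on every level-`(m − 1)` set,
`ρ·#L_m ≤ (cap + 1 − m)·#L_{m−1}` — THE TELESCOPING STEP (`mul_card_levelFNonGiant_le_of_nonColoops`, on the non-giant
sets of S2GiantExactLevels, whose closure is capped). In the `e`-free core at level `7` the coloops are few: `B ∖ K` has
rank `7 − |K|` and `7 − |K| + ν` points, and a set of rank `r ≤ 6` has at most `f_r` points (`f = 1, 3, 6, 10, 19, 39`), so
`7 − |K| ≥ r_min(ν)`, the least `r` with `r + ν ≤ f_r` (`rminF`, RankLevelSetTelForm: `2, 3, 3, 4, 4, 4, 5 … 5, 6 … 6, 7 …`), and the non-coloops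
number at least `ν + r_min(ν)` (`card_nonColoops_ge_of_flat_bounds`). Against the quartic multiplicity `quart(ν) ≈ ν⁴/12`
of the pair count the telescoping ratio `(cap + 1 − m)/(ν + r_min(ν))` wins from level `11` on; the count with the
per-level minimum of the two is Part 2 (S2TelescopeCount). Level-generic except `rminF`. Axioms: standard.
-/

open scoped Matroid

namespace PercRepro

namespace S2

open Set Finset

variable {α : Type} {M : Matroid α}

open scoped Classical in
/-- The non-coloops of a finset `B` at level `q`: the `y ∈ B` with `r(B ∖ y) = q`. -/
noncomputable def nonColoops (M : Matroid α) (q : ℕ) (B : Finset α) : Finset α :=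
  B.filter (fun y => M.eRk ((B.erase y : Finset α) : Set α) = (q : ℕ∞))

open scoped Classical in
/-- Membership in `nonColoops`: `y ∈ B` and `r(B ∖ y) = q`. -/
theorem mem_nonColoops {q : ℕ} {B : Finset α} {y : α} :
    y ∈ nonColoops M q B ↔ y ∈ B ∧ M.eRk ((B.erase y : Finset α) : Set α) = (q : ℕ∞) := by
  unfold nonColoops
  rw [Finset.mem_filter]

open scoped Classical in
/-- A non-coloop lies in the closure of the rest: `r(B ∖ y) = r(B) < ⊤` and `y ∈ E` give `y ∈ cl(B ∖ y)`. -/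
theorem mem_closure_erase_of_eRk_eq {q : ℕ} {B : Finset α} {y : α} (hy : y ∈ B) (hyE : y ∈ M.E)
    (hB : M.eRk (B : Set α) = (q : ℕ∞)) (hS : M.eRk ((B.erase y : Finset α) : Set α) = (q : ℕ∞)) :
    y ∈ M.closure ((B.erase y : Finset α) : Set α) := by
  by_contra hcl
  have h := Matroid.eRk_insert_eq_add_one (M := M) (X := ((B.erase y : Finset α) : Set α)) (e := y) ⟨hyE, hcl⟩
  have hins : (insert y ((B.erase y : Finset α) : Set α)) = (B : Set α) := by
    rw [← Finset.coe_insert, Finset.insert_erase hy]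
  rw [hins, hB, hS] at h
  have h' : ((q : ℕ) : ℕ∞) = ((q + 1 : ℕ) : ℕ∞) := by
    rw [h]; push_cast; rfl
  have := Nat.cast_injective h'
  omega

open scoped Classical in
/-- A non-coloop keeps the closure: `cl(B ∖ y) = cl B`. -/
theorem closure_erase_eq_of_eRk_eq {q : ℕ} {B : Finset α} {y : α} (hy : y ∈ B) (hyE : y ∈ M.E)
    (hB : M.eRk (B : Set α) = (q : ℕ∞)) (hS : M.eRk ((B.erase y : Finset α) : Set α) = (q : ℕ∞)) :
    M.closure ((B.erase y : Finset α) : Set α) = M.closure (B : Set α) := by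
  have hmem := mem_closure_erase_of_eRk_eq hy hyE hB hS
  have h := Matroid.closure_insert_eq_of_mem_closure hmem
  rw [← Finset.coe_insert, Finset.insert_erase hy] at h
  exact h.symm

open scoped Classical in
/-- **THE TELESCOPING STEP on the non-giant level sets**: if every non-giant level-`m` set has at least `ρ` non-coloops and
every non-giant level-`(m − 1)` set has a closure of at most `cap` points, then
`ρ·#NG_m ≤ (cap + 1 − m)·#NG_{m−1}` — the pairs `(B, y)`, `y` a non-coloop of `B`, inject into the pairs `(S, y)` with
`S = B ∖ y` non-giant of level `m − 1` and `y ∈ cl S ∖ S`. -/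
theorem mul_card_levelFNonGiant_le_of_nonColoops [M.Finite] (q f' ν₁ m cap ρ : ℕ)
    (hcap : ∀ S ∈ levelFNonGiant M q f' ν₁ (m - 1), (M.closure (S : Set α)).ncard ≤ cap)
    (hcol : ∀ B ∈ levelFNonGiant M q f' ν₁ m, ρ ≤ (nonColoops M q B).card) :
    ρ * (levelFNonGiant M q f' ν₁ m).card ≤ (cap + 1 - m) * (levelFNonGiant M q f' ν₁ (m - 1)).card := by
  set Lm := levelFNonGiant M q f' ν₁ m with hLm
  set Lm1 := levelFNonGiant M q f' ν₁ (m - 1) with hLm1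
  -- the pairs `(B, y)` and the pairs `(S, y)`
  set X : Finset (Σ _ : Finset α, α) := Lm.sigma (fun B => nonColoops M q B) with hX
  set Y : Finset (Σ _ : Finset α, α) := Lm1.sigma
    (fun S => (Matroid.groundF M).filter (fun y => y ∈ M.closure (S : Set α) ∧ y ∉ S)) with hY
  have hXcard : ρ * Lm.card ≤ X.card := by
    rw [hX, Finset.card_sigma]
    calc ρ * Lm.card = ∑ _B ∈ Lm, ρ := by rw [Finset.sum_const, smul_eq_mul, mul_comm]
      _ ≤ ∑ B ∈ Lm, (nonColoops M q B).card := Finset.sum_le_sum (fun B hB => hcol B hB)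
  have hYcard : Y.card ≤ (cap + 1 - m) * Lm1.card := by
    rw [hY, Finset.card_sigma]
    calc ∑ S ∈ Lm1, ((Matroid.groundF M).filter (fun y => y ∈ M.closure (S : Set α) ∧ y ∉ S)).card
        ≤ ∑ _S ∈ Lm1, (cap + 1 - m) := by
          apply Finset.sum_le_sum
          intro S hS
          -- `S` has `m − 1` elements and a closure of `≤ cap` points
          have hS' := hS
          rw [hLm1, levelFNonGiant, Finset.mem_filter, Matroid.levelF, Finset.mem_filter,
            Finset.mem_powersetCard] at hS'
          obtain ⟨⟨⟨hSsub, hScard⟩, _⟩, _⟩ := hS'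
          have hSE : (S : Set α) ⊆ M.E := by
            rw [← Matroid.coe_groundF M]; exact_mod_cast hSsub
          have hclfin : (M.closure (S : Set α)).Finite :=
            M.ground_finite.subset (M.closure_subset_ground _)
          have hsub : (Matroid.groundF M).filter (fun y => y ∈ M.closure (S : Set α) ∧ y ∉ S) ⊆
              hclfin.toFinset \ S := by
            intro y hy
            rw [Finset.mem_filter] at hy
            rw [Finset.mem_sdiff, Set.Finite.mem_toFinset]
            exact ⟨hy.2.1, hy.2.2⟩
          have hScl : S ⊆ hclfin.toFinset := by
            intro y hy
            rw [Set.Finite.mem_toFinset]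
            exact M.subset_closure (S : Set α) hSE (Finset.mem_coe.2 hy)
          calc ((Matroid.groundF M).filter (fun y => y ∈ M.closure (S : Set α) ∧ y ∉ S)).card
              ≤ (hclfin.toFinset \ S).card := Finset.card_le_card hsub
            _ = hclfin.toFinset.card - S.card := Finset.card_sdiff_of_subset hScl
            _ ≤ cap + 1 - m := by
                have h1 : hclfin.toFinset.card ≤ cap := by
                  rw [← Set.ncard_eq_toFinset_card _ hclfin]; exact hcap S hS
                omega
      _ = (cap + 1 - m) * Lm1.card := by rw [Finset.sum_const, smul_eq_mul, mul_comm]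
  -- the injection `(B, y) ↦ (B ∖ y, y)`
  have hinj : X.card ≤ Y.card := by
    refine Finset.card_le_card_of_injOn (fun x => ⟨x.1.erase x.2, x.2⟩) ?_ ?_
    · intro x hx
      rw [Finset.mem_coe] at hx ⊢
      rw [hX, Finset.mem_sigma] at hx
      obtain ⟨hB, hy⟩ := hx
      rw [mem_nonColoops] at hy
      obtain ⟨hyB, hyr⟩ := hy
      have hB' := hB
      rw [hLm, levelFNonGiant, Finset.mem_filter, Matroid.levelF, Finset.mem_filter,
        Finset.mem_powersetCard] at hB'
      obtain ⟨⟨⟨hBsub, hBcard⟩, hBr⟩, hBng⟩ := hB'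
      have hyE : x.2 ∈ M.E := by
        rw [← Matroid.coe_groundF M]; exact Finset.mem_coe.2 (hBsub hyB)
      have hcl := closure_erase_eq_of_eRk_eq (M := M) hyB hyE hBr hyr
      rw [hY, Finset.mem_sigma]
      refine ⟨?_, ?_⟩
      · rw [hLm1, levelFNonGiant, Finset.mem_filter, Matroid.levelF, Finset.mem_filter,
          Finset.mem_powersetCard]
        refine ⟨⟨⟨(Finset.erase_subset _ _).trans hBsub, ?_⟩, hyr⟩, ?_⟩
        · rw [Finset.card_erase_of_mem hyB, hBcard]
        · rw [hcl]; exact hBng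
      · rw [Finset.mem_filter]
        refine ⟨hBsub hyB, ?_, Finset.notMem_erase _ _⟩
        exact mem_closure_erase_of_eRk_eq hyB hyE hBr hyr
    · intro x hx x' hx' hxx'
      simp only [Sigma.mk.inj_iff] at hxx'
      obtain ⟨h1, h2⟩ := hxx'
      have h2' : x.2 = x'.2 := eq_of_heq h2
      rw [Finset.mem_coe, hX, Finset.mem_sigma] at hx hx'
      have hyB : x.2 ∈ x.1 := (mem_nonColoops.1 hx.2).1
      have hyB' : x'.2 ∈ x'.1 := (mem_nonColoops.1 hx'.2).1
      have h1' : x.1 = x'.1 := by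
        rw [← Finset.insert_erase hyB, ← Finset.insert_erase hyB', h1, h2']
      exact Sigma.ext h1' h2
  calc ρ * Lm.card ≤ X.card := hXcard
    _ ≤ Y.card := hinj
    _ ≤ (cap + 1 - m) * Lm1.card := hYcard

open scoped Classical in
/-- **Coloops drop the rank one by one**: for `K ⊆ B` a set of coloops of `B` (`r(B ∖ y) ≠ r(B)` for `y ∈ K`),
`r(B ∖ K) + |K| = r(B)`. -/
theorem eRk_sdiff_add_card_eq_of_coloops (q : ℕ) (B : Finset α) (hB : (B : Set α) ⊆ M.E)
    (hr : M.eRk (B : Set α) = (q : ℕ∞)) (K : Finset α) (hK : K ⊆ B)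
    (hKcol : ∀ y ∈ K, M.eRk ((B.erase y : Finset α) : Set α) ≠ (q : ℕ∞)) :
    M.eRk ((B \ K : Finset α) : Set α) + (K.card : ℕ∞) = (q : ℕ∞) := by
  induction K using Finset.induction_on with
  | empty => simp [hr]
  | insert y K hyK ih =>
    have hyB : y ∈ B := hK (Finset.mem_insert_self y K)
    have hKB : K ⊆ B := (Finset.subset_insert y K).trans hK
    have ih' := ih hKB (fun z hz => hKcol z (Finset.mem_insert_of_mem hz))
    -- `B ∖ K = insert y (B ∖ insert y K)`, and `y ∉ cl(B ∖ insert y K)`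
    have hsplit : (B \ K : Finset α) = insert y (B \ insert y K) := by
      rw [Finset.sdiff_insert, Finset.insert_erase]
      rw [Finset.mem_sdiff]; exact ⟨hyB, hyK⟩
    have hyE : y ∈ M.E := hB (Finset.mem_coe.2 hyB)
    have hsub : ((B \ insert y K : Finset α) : Set α) ⊆ ((B.erase y : Finset α) : Set α) := by
      intro z hz
      rw [Finset.mem_coe, Finset.mem_sdiff] at hz
      rw [Finset.mem_coe, Finset.mem_erase]
      exact ⟨fun h => hz.2 (h ▸ Finset.mem_insert_self y K), hz.1⟩
    have hnotcl : y ∉ M.closure ((B.erase y : Finset α) : Set α) := by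
      intro hcl
      have h := Matroid.closure_insert_eq_of_mem_closure hcl
      rw [← Finset.coe_insert, Finset.insert_erase hyB] at h
      have h2 : M.eRk ((B.erase y : Finset α) : Set α) = (q : ℕ∞) := by
        rw [← Matroid.eRk_closure_eq, ← h, Matroid.eRk_closure_eq, hr]
      exact hKcol y (Finset.mem_insert_self y K) h2
    have hnotcl' : y ∉ M.closure ((B \ insert y K : Finset α) : Set α) :=
      fun h => hnotcl (M.closure_subset_closure hsub h)
    have hstep := Matroid.eRk_insert_eq_add_one (M := M) (X := ((B \ insert y K : Finset α) : Set α))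
      (e := y) ⟨hyE, hnotcl'⟩
    rw [← Finset.coe_insert, ← hsplit] at hstep
    rw [Finset.card_insert_of_notMem hyK, ← ih', hstep]
    push_cast
    ring

open scoped Classical in
/-- **The non-coloops of a level-`7` set in the `e`-free core**: with the flat bounds `f_r` (`r ≤ 6`), a rank-`7` set `B`
of `7 + ν` points (`ν ≥ 1`) has at least `ν + r_min(ν)` non-coloops — its coloops `K` leave a set of rank `7 − |K|` and
`7 − |K| + ν` points, so `7 − |K| + ν ≤ f_{7 − |K|}`. -/
theorem card_nonColoops_ge_of_flat_bounds [M.Finite] (B : Finset α) (hB : (B : Set α) ⊆ M.E)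
    (hr : M.eRk (B : Set α) = (7 : ℕ∞)) (hcard : 8 ≤ B.card)
    (hf0 : ∀ X ⊆ M.E, M.eRk X ≤ 0 → X.ncard ≤ 0) (hf1 : ∀ X ⊆ M.E, M.eRk X ≤ 1 → X.ncard ≤ 1)
    (hf2 : ∀ X ⊆ M.E, M.eRk X ≤ 2 → X.ncard ≤ 3) (hf3 : ∀ X ⊆ M.E, M.eRk X ≤ 3 → X.ncard ≤ 6)
    (hf4 : ∀ X ⊆ M.E, M.eRk X ≤ 4 → X.ncard ≤ 10) (hf5 : ∀ X ⊆ M.E, M.eRk X ≤ 5 → X.ncard ≤ 19)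
    (hf6 : ∀ X ⊆ M.E, M.eRk X ≤ 6 → X.ncard ≤ 39) :
    (B.card - 7) + rminF (B.card - 7) ≤ (nonColoops M 7 B).card := by
  set K := B.filter (fun y => ¬ M.eRk ((B.erase y : Finset α) : Set α) = ((7 : ℕ) : ℕ∞)) with hKdef
  have hsplit : (nonColoops M 7 B).card + K.card = B.card := by
    rw [hKdef]
    unfold nonColoops
    exact Finset.card_filter_add_card_filter_not _
  have hKB : K ⊆ B := Finset.filter_subset _ _
  have hKcol : ∀ y ∈ K, M.eRk ((B.erase y : Finset α) : Set α) ≠ ((7 : ℕ) : ℕ∞) := by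
    intro y hy
    rw [hKdef, Finset.mem_filter] at hy
    exact hy.2
  have hrank := eRk_sdiff_add_card_eq_of_coloops (M := M) 7 B hB (by exact_mod_cast hr) K hKB hKcol
  -- the rank of `B ∖ K` as a natural number `r` with `r + |K| = 7`
  have hfin : M.eRk ((B \ K : Finset α) : Set α) ≠ ⊤ := by
    intro h; rw [h] at hrank; simp at hrank
  obtain ⟨r, hr'⟩ : ∃ r : ℕ, M.eRk ((B \ K : Finset α) : Set α) = (r : ℕ∞) :=
    ⟨(M.eRk ((B \ K : Finset α) : Set α)).toNat, (ENat.coe_toNat hfin).symm⟩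
  rw [hr'] at hrank
  have hrK : r + K.card = 7 := by exact_mod_cast hrank
  have hBK : (B \ K).card = B.card - K.card := Finset.card_sdiff_of_subset hKB
  have hBKE : ((B \ K : Finset α) : Set α) ⊆ M.E := (Finset.coe_subset.2 (Finset.sdiff_subset)).trans hB
  have hBKn : ((B \ K : Finset α) : Set α).ncard = B.card - K.card := by
    rw [Set.ncard_coe_finset, hBK]
  -- the flat bounds on `B ∖ K`
  have hb : ∀ j : ℕ, j ≤ 6 → r ≤ j → ((B \ K : Finset α) : Set α).ncard ≤
      (if j = 0 then 0 else if j = 1 then 1 else if j = 2 then 3 else if j = 3 then 6 else if j = 4 then 10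
        else if j = 5 then 19 else 39) := by
    intro j hj6 hj
    have hle : M.eRk ((B \ K : Finset α) : Set α) ≤ (j : ℕ∞) := by rw [hr']; exact_mod_cast hj
    split_ifs with h0 h1 h2 h3 h4 h5
    · subst h0; exact hf0 _ hBKE (by exact_mod_cast hle)
    · subst h1; exact hf1 _ hBKE (by exact_mod_cast hle)
    · subst h2; exact hf2 _ hBKE (by exact_mod_cast hle)
    · subst h3; exact hf3 _ hBKE (by exact_mod_cast hle)
    · subst h4; exact hf4 _ hBKE (by exact_mod_cast hle)
    · subst h5; exact hf5 _ hBKE (by exact_mod_cast hle)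
    · have hj6' : j = 6 := by omega
      subst hj6'
      exact hf6 _ hBKE (by exact_mod_cast hle)
  have h6 : K.card < 1 ∨ B.card - K.card ≤ 39 := by
    by_cases h : 1 ≤ K.card
    · right
      have := hb 6 (by norm_num) (by omega)
      simp only [show (6 : ℕ) ≠ 0 by norm_num, show (6 : ℕ) ≠ 1 by norm_num, show (6 : ℕ) ≠ 2 by norm_num,
        show (6 : ℕ) ≠ 3 by norm_num, show (6 : ℕ) ≠ 4 by norm_num, show (6 : ℕ) ≠ 5 by norm_num,
        if_false] at this
      rwa [hBKn] at this
    · left; omega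
  have h5 : K.card < 2 ∨ B.card - K.card ≤ 19 := by
    by_cases h : 2 ≤ K.card
    · right
      have := hb 5 (by norm_num) (by omega)
      simp only [show (5 : ℕ) ≠ 0 by norm_num, show (5 : ℕ) ≠ 1 by norm_num, show (5 : ℕ) ≠ 2 by norm_num,
        show (5 : ℕ) ≠ 3 by norm_num, show (5 : ℕ) ≠ 4 by norm_num, if_false, if_true] at this
      rwa [hBKn] at this
    · left; omega
  have h4 : K.card < 3 ∨ B.card - K.card ≤ 10 := by
    by_cases h : 3 ≤ K.card
    · right
      have := hb 4 (by norm_num) (by omega)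
      simp only [show (4 : ℕ) ≠ 0 by norm_num, show (4 : ℕ) ≠ 1 by norm_num, show (4 : ℕ) ≠ 2 by norm_num,
        show (4 : ℕ) ≠ 3 by norm_num, if_false, if_true] at this
      rwa [hBKn] at this
    · left; omega
  have h3 : K.card < 4 ∨ B.card - K.card ≤ 6 := by
    by_cases h : 4 ≤ K.card
    · right
      have := hb 3 (by norm_num) (by omega)
      simp only [show (3 : ℕ) ≠ 0 by norm_num, show (3 : ℕ) ≠ 1 by norm_num, show (3 : ℕ) ≠ 2 by norm_num,
        if_false, if_true] at this
      rwa [hBKn] at this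
    · left; omega
  have h2 : K.card < 5 ∨ B.card - K.card ≤ 3 := by
    by_cases h : 5 ≤ K.card
    · right
      have := hb 2 (by norm_num) (by omega)
      simp only [show (2 : ℕ) ≠ 0 by norm_num, show (2 : ℕ) ≠ 1 by norm_num, if_false, if_true] at this
      rwa [hBKn] at this
    · left; omega
  have h1 : K.card < 6 ∨ B.card - K.card ≤ 1 := by
    by_cases h : 6 ≤ K.card
    · right
      have := hb 1 (by norm_num) (by omega)
      simp only [show (1 : ℕ) ≠ 0 by norm_num, if_false, if_true] at this
      rwa [hBKn] at this
    · left; omega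
  have h0 : K.card < 7 ∨ B.card - K.card ≤ 0 := by
    by_cases h : 7 ≤ K.card
    · right
      have := hb 0 (by norm_num) (by omega)
      simp only [if_true] at this
      rwa [hBKn] at this
    · left; omega
  have hKle : K.card ≤ B.card := Finset.card_le_card hKB
  unfold rminF
  split_ifs <;> omega

end S2

end PercRepro
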